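import Summits.ResolutionOfSingularities.ResolutionOfSingularities.Theorems.PurelyInseparableDim4LeafStepIntrinsic
import Summits.ResolutionOfSingularities.ResolutionOfSingularities.Theorems.PurelyInseparableDim4LoopCLocalEscape
import HarnessLib
import HarnessLib.Audit.Tags

/-!
# Purely inseparable fourfolds — the LEAF RULE of the LOCAL in-scope game: every «d = 0» leaf is an
# A-win when B answers over the current point (cell res-dim4-pi, WORD #38 (a)(2) / WORD #53 (b) D2)
# [OURS · counted 0 · a statement about OUR coordinate-centre frame, not about resolution]

Width seat `res-dim4-p-10` (g2).  The LOCAL in-scope game of desk RULING R1 (WORD #45) — A blows up a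
permissible coordinate centre at an in-scope state, B answers with an equimultiple point OVER THE
CURRENT POINT (`bᵢ = 0` off the centre; the fibre coordinates are free) — is in the tree as
res-dim4-p-6 g2's reply-class attractor `LoopCLocal.RWins q LoopCLocal.localB` (`…LoopCLocalEscape`;
`RWins q ⊤ = InScopeStateWins q` is the GLOBAL game of record).  From the bookkeeping-free leaf step
(`LeafStep.leafStep_fibre_of_exponent`: cardinality-first centre + local equimultiple reply ⇒ leaf with
smaller `|a|`) by strong induction on `|a|`:

* **`rWins_local_of_exponent`** — every state whose `F` is monomial × unit (`x^a ∣ F`, `coeff_a F ≠ 0`)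
  with `x^a` not a `q`-th power is an A-win of the LOCAL in-scope game, A playing any MODE-1h
  (cardinality-first) centre; any field, any `q ≥ 1`, any books `r`, `exc`;
* `rWins_local_of_leaf` (booked form `a = r`), `rWins_local_monomial` (pure monomial terms).

This is the LEAF RULE the desk asked for, in the only game in which it holds: citable for LOCAL
certificates (`LoopCLocal.rwinCertB q localB` rows may stop at such states); it is FALSE for the global
reply set (`…LeafStepSpecimens`: X0/X1/X2), where leaf rows keep their along-centre children.  When
res-dim4-p-13's `EdgeLoc` lands, `RSucc q localB` ↔ `EdgeLoc` is a one-line bridge (one owner: p-13/p-6).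
Nothing here proves resolution of singularities in dimension ≥ 4 / characteristic `p`; counted 0; AI
work, weaker than expert review. bears_on: LADDER-RESOLUTION:D157-DOOR2 (res-dim4-pi · WORD #53 (b) D2 ·
F4-C-loc). Supports stmt-ResolutionOfSingularities-16155 (helper).
-/

set_option linter.dupNamespace false

open MvPolynomial Finset

open scoped BigOperators

noncomputable section

namespace Summit.ResolutionOfSingularities.ResolutionOfSingularities.Theorems.PIDim4

namespace LeafStep

open Literature.AlgebraicGeometry.Resolution
open Literature.AlgebraicGeometry.Resolution.Hauser2010
open CentreBlowup LoopCLocal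

variable {K : Type} [Field K] [DecidableEq K]

omit [DecidableEq K] in
/-- **A permissible centre of least cardinality exists** as soon as some permissible centre exists.
[folklore] -/
theorem exists_isMode1hCentre {q : ℕ} {F : MvPolynomial (Fin 4) K} {S₀ : Finset (Fin 4)}
    (h : IsPermissibleCentre q S₀ F) : ∃ S, IsMode1hCentre q S F := by
  classical
  obtain ⟨S, hS, hmin⟩ := Finset.exists_min_image
    (Finset.univ.filter fun S : Finset (Fin 4) => IsPermissibleCentre q S F) Finset.card
    ⟨S₀, Finset.mem_filter.mpr ⟨Finset.mem_univ _, h⟩⟩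
  exact ⟨S, (Finset.mem_filter.mp hS).2, fun S' hS' =>
    hmin S' (Finset.mem_filter.mpr ⟨Finset.mem_univ _, hS'⟩)⟩

/-- **LEAF RULE OF THE LOCAL GAME (bookkeeping-free).** If `x^a ∣ F`, `coeff_a F ≠ 0` and `x^a` is not a
`q`-th power (`q ≥ 1`), the state is an A-win of the LOCAL in-scope game `RWins q localB` — A plays a
cardinality-first permissible centre while the origin is `q`-fold and in scope; every reply of B over the
current point is again such a state with smaller `|a|` (`leafStep_fibre_of_exponent`).
[OURS · counted 0] [folklore] -/
theorem rWins_local_of_exponent {q : ℕ} (hq : 0 < q) (s : State K) (a : Fin 4 →₀ ℕ)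
    (hdiv : ∀ d ∈ s.F.support, a ≤ d) (ha0 : coeff a s.F ≠ 0) (hcl : ¬ ∀ i, q ∣ a i) :
    RWins q localB s := by
  -- strong induction on `|a|`
  suffices h : ∀ n (s : State K) (a : Fin 4 →₀ ℕ), a.degree = n → (∀ d ∈ s.F.support, a ≤ d) →
      coeff a s.F ≠ 0 → (¬ ∀ i, q ∣ a i) → RWins q localB s from h _ s a rfl hdiv ha0 hcl
  intro n
  induction n using Nat.strong_induction_on with
  | _ n IH =>
    intro s a hn hdiv ha0 hcl
    by_cases hsc : InCoordinateScope q s.F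
    · by_cases hex : ∃ S₀, IsPermissibleCentre q S₀ s.F
      · obtain ⟨S₀, hS₀⟩ := hex
        obtain ⟨S, hS⟩ := exists_isMode1hCentre hS₀
        refine Game.Wins.move (m := S) ⟨hsc, hS.1⟩ fun s' hs' => ?_
        obtain ⟨j, b, hj, hbj, hloc, heq, -, rfl⟩ := hs'
        have hfib : ∀ i, i ∉ S → b i = 0 := (localB_eq_true_iff S j b).mp hloc
        obtain ⟨h1, h2, h3, h4, -⟩ := leafStep_fibre_of_exponent hq hj hbj hfib s a hdiv ha0 hcl
          hS.1.2 (fun S' hS' hq' => hS.2 S' ⟨hS', hq'⟩) heq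
        exact IH _ (hn ▸ h4) _ _ rfl h1 h2 h3
      · exact Game.Wins.terminal fun S hS => hex ⟨S, hS.2⟩
    · exact Game.Wins.terminal fun S hS => hsc hS.1

/-- **LEAF RULE OF THE LOCAL GAME (booked form).** A d = 0 leaf as bookkept (`x^r ∣ F`, `coeff_r F ≠ 0`,
`x^r` not a `q`-th power) is an A-win of the local in-scope game. [OURS · counted 0] [folklore] -/
theorem rWins_local_of_leaf {q : ℕ} (hq : 0 < q) (s : State K)
    (hdiv : ∀ d ∈ s.F.support, s.r ≤ d) (hd0 : coeff s.r s.F ≠ 0) (hcl : ¬ ∀ i, q ∣ s.r i) :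
    RWins q localB s :=
  rWins_local_of_exponent hq s s.r hdiv hd0 hcl

/-- **Every PURE MONOMIAL TERM is an A-win of the local in-scope game**: `F = c · x^a`, `c ≠ 0`, `x^a`
not a `q`-th power, any books. [OURS · counted 0] [folklore] -/
theorem rWins_local_monomial {q : ℕ} (hq : 0 < q) (a : Fin 4 →₀ ℕ) {c : K} (hc : c ≠ 0)
    (hcl : ¬ ∀ i, q ∣ a i) (r : Fin 4 →₀ ℕ) (exc : Finset (Fin 4)) :
    RWins q localB (⟨monomial a c, r, exc⟩ : State K) := by
  refine rWins_local_of_exponent hq _ a (fun d hd => ?_) (by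
    change coeff a (monomial a c) ≠ 0
    rwa [coeff_monomial, if_pos rfl]) hcl
  change d ∈ (monomial a c).support at hd
  classical
  rw [support_monomial, if_neg hc, Finset.mem_singleton] at hd
  rw [hd]

/-- **The local game versus the global one at a leaf** (reading of the specimens): the pure-monomial
leaf `x₀⁴x₁x₂` of specimen X1 is an A-win of the LOCAL game at `(p,q) = (2,2)` over every field, while
in the GLOBAL game B's reply `(0,1,1,0)` along the forced centre `{x₀}` leaves the leaf class
(`LeafStep.Specimens.x1_rise`). [OURS · counted 0] [folklore] -/
theorem rWins_local_x1 (r : Fin 4 →₀ ℕ) (exc : Finset (Fin 4)) :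
    RWins 2 localB (⟨monomial (StepKit.expo ![4, 1, 1, 0]) 1, r, exc⟩ : State K) :=
  rWins_local_monomial (by norm_num) _ one_ne_zero
    (fun h => absurd (h 1) (by rw [StepKit.expo_apply]; decide)) r exc

/-! ## Certificate form: a presented state passes three list checks ⇒ local A-win -/

/-- **LEAF RULE FOR LOCAL CERTIFICATES** (`decide`-able hypotheses on a presented state `s : SData 4 K`
and a candidate exponent `m`): every live exponent dominates `m`, the list coefficient at `m` is non-zero,
some `mᵢ` is not divisible by `q` ⇒ `RWins q localB s.toState`.  A LOCAL win certificate
(`LoopCLocal.rwinCertB q localB`) may therefore stop at such rows. [OURS · counted 0] [folklore] -/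
theorem rWins_local_of_checks {q : ℕ} (hq : 0 < q) (s : StepKit.SData 4 K) (m : Fin 4 → ℕ)
    (h1 : ((StepKit.live s.L).all fun e => decide (∀ i, m i ≤ e i)) = true)
    (h2 : StepKit.coeffAt s.L m ≠ 0) (h3 : ¬ ∀ i, q ∣ m i) :
    RWins q localB s.toState := by
  refine rWins_local_of_exponent hq s.toState (StepKit.expo m) (fun d hd => ?_) ?_ ?_
  · rw [StepKit.SData.toState_F, StepKit.mem_support_evalT_iff] at hd
    rw [List.all_eq_true] at h1
    have key := of_decide_eq_true (h1 _ hd)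
    exact Finsupp.le_def.mpr fun i => by rw [StepKit.expo_apply]; exact key i
  · rw [StepKit.SData.toState_F, StepKit.coeff_expo_evalT]; exact h2
  · intro h; apply h3; intro i; have := h i; rwa [StepKit.expo_apply] at this

/-- Usage (specimen X0♭'s parent `x₀x₁(1 + x₁ + x₂)` over `𝔽₂`, `q = 2`, exponent `m = (1,1,0,0)`): a local
A-win by three `decide`s. [OURS · counted 0] [folklore] -/
theorem rWins_local_x0b :
    RWins 2 localB (⟨[(![1, 1, 0, 0], 1), (![1, 2, 0, 0], 1), (![1, 1, 1, 0], 1)], ![1, 1, 0, 0], {0, 1}⟩ :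
      StepKit.SData 4 (ZMod 2)).toState :=
  rWins_local_of_checks (by norm_num) _ ![1, 1, 0, 0] (by decide) (by decide)
    (fun h => absurd (h 0) (by decide))

end LeafStep

end Summit.ResolutionOfSingularities.ResolutionOfSingularities.Theorems.PIDim4

end
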